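import Literature.AlgebraicTopology.SingularHomology.WuClasses
import Literature.AlgebraicTopology.SingularHomology.ModPBettiNumbers
import Literature.AlgebraicTopology.SingularHomology.CupProductProofs
import Literature.AlgebraicTopology.SingularHomology.PoincareDualityProofs
import Literature.AlgebraicTopology.SingularHomology.UniversalCoefficientsField
import Literature.AlgebraicTopology.SingularHomology.CohomologyFiniteness
import Mathlib.LinearAlgebra.BilinearForm.Orthogonal
import HarnessLib

/-!
# `χ(M) ≡ ⟨v_m ⌣ v_m, [M]₂⟩ (mod 2)` for a closed `2m`-manifold: the Euler characteristic is the
# Wu number `v_m²[M]` (Milnor–Stasheff Cor. 11.15 / Thm. 11.14 in Wu form)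

J. W. Milnor, J. D. Stasheff, *Characteristic Classes*, Ann. of Math. Studies 76 (1974), §11:
Thm. 11.14 (Wu's formula `w = Sq(v)`, so the top Stiefel–Whitney class of a closed smooth
`n`-manifold is `wₙ = Σᵢ Sqⁱ v_{n-i}`, whose value on `[M]` is `Σᵢ ⟨vᵢ ⌣ v_{n-i}, [M]⟩`) and
Cor. 11.12 / Cor. 11.15 (`wₙ[M] ≡ χ(M) (mod 2)`; `⟨v ⌣ v, [M]⟩ = χ(M) mod 2` with `v` the total Wu
class).  For `n = 2m` the only surviving Wu class product is `v_m ⌣ v_m` (`vₖ = 0` for `2k > n`),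
so the statement is: **`⟨v_m ⌣ v_m, [M]₂⟩ = χ(M) mod 2`**.

This file PROVES that identity for every closed TOPOLOGICAL `2m`-manifold (compact, Hausdorff,
charted on `ℝ²ᵐ`), directly from Poincaré duality with `𝔽₂` coefficients — no Stiefel–Whitney
classes are needed — along the classical linear-algebra route:

* §1 (linear algebra in characteristic two)
  `even_finrank_of_forall_apply_self_eq_zero` — a nonsingular ALTERNATING bilinear form lives on
  an even-dimensional space; `apply_self_eq_finrank_of_forall_apply_self_eq` — for a nonsingular
  symmetric bilinear form `B` on a finite-dimensional `𝔽₂`-space `V`, the *characteristic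
  element* `v` (`B(x, x) = B(v, x)` for all `x`; it exists and is unique because `x ↦ B(x, x)` is
  linear over `𝔽₂`) satisfies **`B(v, v) = dim V (mod 2)`** (orthogonal splitting off an
  anisotropic vector, Milnor–Husemoller style; the `𝔽₂`-analogue of van der Blij's lemma);
* §2 `sum_finrank_eq_finrank_middle_mod_two` — for a closed `2m`-manifold the mod-2 Betti
  numbers satisfy `bₖ = b_{2m-k}` (Poincaré duality over the field `𝔽₂`, Hatcher Cor. 3.37,
  here from the tree's PROVED `poincare_duality` and `kroneckerPairing_bijective_of_field`),
  hence `Σₖ (-1)ᵏ bₖ ≡ b_m (mod 2)`;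
* §3 **`kroneckerPairing_wuClass_sq_eq_eulerChar`** — for a closed topological `n`-manifold
  `X`, `n = m + m`:
  `⟨v_m ⌣ v_m, [X]₂⟩ = (Σ_{k ≤ n} (-1)ᵏ rank Hₖ(X; ℤ)) mod 2`.
  Proof: the cup pairing on `Hᵐ(X; 𝔽₂)` is nonsingular (Hatcher Prop. 3.38, the tree's
  `isPerfPair_cupPairing_of_field_holds`) and symmetric (graded commutativity, signs die mod 2),
  and `B(x, x) = ⟨x ⌣ x, [X]⟩ = ⟨Sqᵐ x, [X]⟩ = ⟨v_m ⌣ x, [X]⟩` (`steenrodSq_self`,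
  `cupPairing_wuClass`): the Wu class IS the characteristic element, so §1 gives
  `⟨v_m², [X]⟩ = dim Hᵐ(X; 𝔽₂) = b_m`, and §2 with the field-independence of the Euler
  characteristic (`eulerChar_int_eq_eulerChar_zmod`, Hatcher §3.A Ex. 1) finishes.

Everything is proved; no definitions, no named facts.  Written in support of
`Literature.Topology.FourManifolds.natCard_unorientedBordismClass_four` (it identifies the first
coordinate `χ mod 2` of Thom's invariant on `𝔑₄` with the Stiefel–Whitney number `w₄ = v₂²`).

## References

* J. W. Milnor, J. D. Stasheff, *Characteristic Classes*, Ann. of Math. Studies 76 (1974), §11: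
  Thm. 11.14, Cor. 11.12, Cor. 11.15. [MilnorStasheff1974]
* J. Milnor, D. Husemoller, *Symmetric Bilinear Forms*, Springer 1973, Ch. I (orthogonal
  splitting of inner product spaces). [MilnorHusemoller1973]
* A. Hatcher, *Algebraic Topology*, CUP 2002, §3.3 Cor. 3.37 and Prop. 3.38, §3.A Cor. 3A.6 and
  Exercise 1. [HatcherAT2002]
-/

noncomputable section

open CategoryTheory Set Function Module

universe u v

namespace Literature.AlgebraicTopology.SingularHomology

/-! ### §1 Linear algebra: alternating forms are even-dimensional; `B(v, v) = dim V` over `𝔽₂` -/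

section Forms

variable {K : Type*} [Field K]

/-- In `ℤ/2` a nonzero element is `1`. [folklore] -/
private lemma zmod_two_eq_one_of_ne_zero' {c : ZMod 2} (h : c ≠ 0) : c = 1 := by
  revert h c; decide

/-- A symmetric left-nonsingular bilinear form is nondegenerate (both-sided) and reflexive. [folklore] -/
private lemma nondegenerate_and_isRefl_of_symm {V : Type v} [AddCommGroup V] [Module K V]
    (B : LinearMap.BilinForm K V) (hsymm : ∀ x y, B x y = B y x)
    (hsep : ∀ x, (∀ y, B x y = 0) → x = 0) : B.Nondegenerate ∧ B.IsRefl :=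
  ⟨⟨hsep, fun y hy => hsep y fun x => (hsymm y x).trans (hy x)⟩,
    fun x y h => (hsymm y x).trans h⟩

/-- **A nonsingular alternating bilinear form lives on an even-dimensional space** (split off a
hyperbolic plane `⟨x, y⟩`, `B(x, y) = 1`, and induct on the orthogonal complement;
Milnor–Husemoller 1973, Ch. I). [cite: MilnorHusemoller1973, Ch. I (orthogonal splitting of inner product spaces)] -/
theorem even_finrank_of_forall_apply_self_eq_zero (n : ℕ) :
    ∀ {V : Type v} [AddCommGroup V] [Module K V] [FiniteDimensional K V]
      (B : LinearMap.BilinForm K V), (∀ x, B x x = 0) → (∀ x, (∀ y, B x y = 0) → x = 0) →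
      Module.finrank K V = n → Even n := by
  induction n using Nat.strong_induction_on with
  | _ n ih => ?_
  intro V _ _ _ B halt hsep hn
  -- skew-symmetry from alternation
  have hskew : ∀ x y, B y x = -B x y := fun x y => by
    have h := halt (x + y)
    simp only [map_add, LinearMap.add_apply, halt x, halt y, zero_add, add_zero] at h
    linear_combination h
  have hrefl : B.IsRefl := fun x y h => by rw [hskew, h, neg_zero]
  rcases Nat.eq_zero_or_pos n with rfl | hnpos
  · exact ⟨0, rfl⟩
  -- a hyperbolic pair `x, y`
  obtain ⟨x, hx⟩ : ∃ x : V, x ≠ 0 := by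
    rw [← Module.finrank_pos_iff_exists_ne_zero (R := K), hn]
    exact hnpos
  obtain ⟨y, hxy⟩ : ∃ y, B x y = 1 := by
    obtain ⟨y₀, hy₀⟩ := not_forall.1 fun h => hx (hsep x h)
    exact ⟨(B x y₀)⁻¹ • y₀, by rw [map_smul, smul_eq_mul, inv_mul_cancel₀ hy₀]⟩
  have hyx : B y x = -1 := by rw [hskew, hxy]
  have hxx := halt x
  have hyy := halt y
  -- the plane they span, and nondegeneracy of `B` on it
  set W : Submodule K V := Submodule.span K {x, y} with hWdef
  have hxW : x ∈ W := Submodule.subset_span (by simp)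
  have hyW : y ∈ W := Submodule.subset_span (by simp)
  have hmemW : ∀ {w : V}, w ∈ W → ∃ a b : K, a • x + b • y = w := fun {w} hw =>
    Submodule.mem_span_pair.1 hw
  have hW : (B.restrict W).Nondegenerate := by
    constructor
    · intro w hw
      obtain ⟨a, b, hab⟩ := hmemW w.2
      have h1 := hw ⟨y, hyW⟩
      have h2 := hw ⟨x, hxW⟩
      simp only [LinearMap.BilinForm.restrict_apply, LinearMap.domRestrict_apply, ← hab, map_add,
        map_smul, LinearMap.add_apply, LinearMap.smul_apply, smul_eq_mul, hxy, hyy, hxx, hyx,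
        mul_one, mul_zero, add_zero, zero_add, mul_neg, neg_eq_zero] at h1 h2
      apply Subtype.ext
      change (w : V) = 0
      rw [← hab, h1, h2, zero_smul, zero_smul, add_zero]
    · intro w hw
      obtain ⟨a, b, hab⟩ := hmemW w.2
      have h1 := hw ⟨y, hyW⟩
      have h2 := hw ⟨x, hxW⟩
      simp only [LinearMap.BilinForm.restrict_apply, LinearMap.domRestrict_apply, ← hab, map_add,
        map_smul, smul_eq_mul, hxy, hyy, hxx, hyx, mul_one, mul_zero, add_zero, zero_add, mul_neg,
        neg_eq_zero] at h1 h2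
      apply Subtype.ext
      change (w : V) = 0
      rw [← hab, h1, h2, zero_smul, zero_smul, add_zero]
  have hc : IsCompl W (B.orthogonal W) := B.isCompl_orthogonal_of_restrict_nondegenerate hrefl hW
  -- `dim W = 2`
  have hW2 : Module.finrank K W = 2 := by
    have hli : LinearIndependent K ![x, y] := by
      rw [LinearIndependent.pair_iff]
      intro s t hst
      have h1 : B (s • x + t • y) y = 0 := by rw [hst, map_zero, LinearMap.zero_apply]
      have h2 : B x (s • x + t • y) = 0 := by rw [hst, map_zero]
      simp only [map_add, map_smul, LinearMap.add_apply, LinearMap.smul_apply, smul_eq_mul, hxy,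
        hyy, hxx, mul_one, mul_zero, add_zero, zero_add] at h1 h2
      exact ⟨h1, h2⟩
    have h := finrank_span_eq_card hli
    rw [Matrix.range_cons_cons_empty, Fintype.card_fin] at h
    exact h
  -- the orthogonal complement carries a nonsingular alternating form of smaller dimension
  set U : Submodule K V := B.orthogonal W with hUdef
  have hUsep : ∀ u : U, (∀ u' : U, B.restrict U u u' = 0) → u = 0 := by
    intro u hu
    apply Subtype.ext
    refine hsep u.1 fun z => ?_
    have hz : z ∈ W ⊔ U := by rw [hc.sup_eq_top]; exact Submodule.mem_top
    obtain ⟨w, hw, u', hu', rfl⟩ := Submodule.mem_sup.1 hz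
    have h1 : B u.1 w = 0 := by
      rw [hskew, (LinearMap.BilinForm.mem_orthogonal_iff.1 u.2) w hw, neg_zero]
    have h2 : B u.1 u' = 0 := by
      simpa only [LinearMap.BilinForm.restrict_apply, LinearMap.domRestrict_apply] using hu ⟨u', hu'⟩
    rw [map_add, h1, h2, add_zero]
  have hdim : Module.finrank K U + 2 = n := by
    rw [← hn, ← Submodule.finrank_add_eq_of_isCompl hc, hW2, add_comm]
  have haltU : ∀ u : U, B.restrict U u u = 0 := fun u => by
    simp only [LinearMap.BilinForm.restrict_apply, LinearMap.domRestrict_apply]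
    exact halt u.1
  have hU := ih (Module.finrank K U) (by omega) (B.restrict U) haltU hUsep rfl
  rw [← hdim]
  exact hU.add (by decide)

/-- **The characteristic element of a nonsingular symmetric bilinear form over `𝔽₂` has
`B(v, v) = dim V (mod 2)`.**  For a finite-dimensional `𝔽₂`-space `V` with a left-nonsingular
symmetric bilinear form `B` and `v ∈ V` with `B(x, x) = B(v, x)` for all `x`:
`B(v, v) = dim V` in `𝔽₂`.  (If some `B(x, x) ≠ 0`, split `V = 𝔽₂x ⊕ x^⊥`: the component of `v`
in `x^⊥` is the characteristic element there and the coefficient of `x` is `1`; if `B` is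
alternating, `B(v, v) = 0` and `dim V` is even.)  The mod-2 shadow of van der Blij's lemma
(Milnor–Husemoller 1973, Ch. II §5) and the algebra behind `w_n[M] = χ(M) mod 2`
(Milnor–Stasheff 1974, Cor. 11.15). [cite: MilnorHusemoller1973, Ch. I (orthogonal splitting) and App. 1–2] [cite: MilnorStasheff1974, §11 Cor. 11.15] -/
theorem apply_self_eq_finrank_of_forall_apply_self_eq (n : ℕ) :
    ∀ {V : Type v} [AddCommGroup V] [Module (ZMod 2) V] [FiniteDimensional (ZMod 2) V]
      (B : LinearMap.BilinForm (ZMod 2) V) (v : V), (∀ x y, B x y = B y x) →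
      (∀ x, (∀ y, B x y = 0) → x = 0) → (∀ x, B x x = B v x) →
      Module.finrank (ZMod 2) V = n → B v v = (n : ZMod 2) := by
  haveI : Fact (Nat.Prime 2) := ⟨Nat.prime_two⟩
  induction n using Nat.strong_induction_on with
  | _ n ih => ?_
  intro V _ _ _ B v hsymm hsep hchar hn
  obtain ⟨hB, hrefl⟩ := nondegenerate_and_isRefl_of_symm B hsymm hsep
  by_cases halt : ∀ x, B x x = 0
  · -- alternating: `B(v, v) = 0` and the dimension is even
    rw [halt v, eq_comm, ZMod.natCast_eq_zero_iff_even]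
    exact even_finrank_of_forall_apply_self_eq_zero n B halt hsep hn
  obtain ⟨x, hx⟩ := not_forall.1 halt
  have hx1 : B x x = 1 := zmod_two_eq_one_of_ne_zero' hx
  have hx0 : x ≠ 0 := fun h => hx (by simp [h])
  -- split `V = 𝔽₂ x ⊕ U`, `U = x^⊥`
  set U : Submodule (ZMod 2) V := B.orthogonal (Submodule.span (ZMod 2) {x}) with hUdef
  have hU : (B.restrict U).Nondegenerate :=
    B.restrict_nondegenerate_orthogonal_spanSingleton hB hrefl hx
  have hc : IsCompl (Submodule.span (ZMod 2) {x}) U :=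
    LinearMap.BilinForm.isCompl_span_singleton_orthogonal hx
  have hxU : ∀ {u : V}, u ∈ U → B x u = 0 := fun {u} hu =>
    (LinearMap.BilinForm.mem_orthogonal_iff.1 hu) x (Submodule.mem_span_singleton_self x)
  -- decompose `v = a • x + u`
  have hv : v ∈ Submodule.span (ZMod 2) {x} ⊔ U := by rw [hc.sup_eq_top]; exact Submodule.mem_top
  obtain ⟨y, hy, u, hu, hyu⟩ := Submodule.mem_sup.1 hv
  obtain ⟨a, rfl⟩ := Submodule.mem_span_singleton.1 hy
  -- `u` is the characteristic element of `B|U`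
  have hcharU : ∀ z : U, B.restrict U z z = B.restrict U ⟨u, hu⟩ z := by
    intro z
    simp only [LinearMap.BilinForm.restrict_apply, LinearMap.domRestrict_apply]
    have h := hchar z.1
    rw [← hyu] at h
    simpa only [map_add, map_smul, LinearMap.add_apply, LinearMap.smul_apply, hxU z.2, smul_zero,
      zero_add] using h
  have hdim : Module.finrank (ZMod 2) U + 1 = n := by
    rw [← hn, ← Submodule.finrank_add_eq_of_isCompl hc, finrank_span_singleton hx0, add_comm]
  have hUU := ih (Module.finrank (ZMod 2) U) (by omega) (B.restrict U) ⟨u, hu⟩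
    (fun z z' => by
      simpa only [LinearMap.BilinForm.restrict_apply, LinearMap.domRestrict_apply] using hsymm z.1 z'.1)
    hU.1 hcharU rfl
  simp only [LinearMap.BilinForm.restrict_apply, LinearMap.domRestrict_apply] at hUU
  have hux : B u x = 0 := by rw [hsymm u x, hxU hu]
  -- the coefficient of `x` is `1`
  have ha : a = 1 := by
    have h := hchar x
    rw [← hyu] at h
    simp only [map_add, map_smul, LinearMap.add_apply, LinearMap.smul_apply, hx1, smul_eq_mul,
      mul_one, hux, add_zero] at h
    exact h.symm
  subst ha
  rw [one_smul] at hyu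
  -- `B(v, v) = B(x, x) + B(u, u) = 1 + dim U`
  rw [← hyu]
  simp only [map_add, LinearMap.add_apply, hx1, hxU hu, hux, hUU, add_zero, zero_add]
  rw [← hdim, Nat.cast_add, Nat.cast_one, add_comm]

end Forms

/-! ### §2 Mod-2 Betti numbers of a closed `2m`-manifold: `bₖ = b_{2m-k}`, `Σ (-1)ᵏ bₖ ≡ b_m` -/

section Betti

variable {n : ℕ} (X : Type u) [TopologicalSpace X] [T2Space X] [CompactSpace X]
  [ChartedSpace (EuclideanSpace ℝ (Fin n)) X]

/-- **Poincaré duality for mod-2 Betti numbers**: on a closed topological `n`-manifold,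
`dim Hₚ(X; 𝔽₂) = dim H_q(X; 𝔽₂)` for `p + q = n` (Hatcher 2002, Cor. 3.37 over the field `𝔽₂`,
every manifold being `𝔽₂`-orientable: `D : Hᵖ ≅ H_q` is the tree's `poincare_duality`, and
`dim Hᵖ = dim Hₚ` by the universal coefficient theorem over a field,
`finrank_singularCohomology_eq_bettiNumber_of_field`). [cite: HatcherAT2002, §3.3 Cor. 3.37] -/
theorem finrank_singularHomology_zmod_two_eq_of_add_eq {p q : ℕ} (h : p + q = n) :
    Module.finrank (ZMod 2) (singularHomology (ZMod 2) (ZMod 2) X p) =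
      Module.finrank (ZMod 2) (singularHomology (ZMod 2) (ZMod 2) X q) := by
  haveI : Fact (Nat.Prime 2) := ⟨Nat.prime_two⟩
  have hD := poincare_duality (modTwoOrientation X n) h
  rw [← (LinearEquiv.ofBijective _ hD).finrank_eq,
    finrank_singularCohomology_eq_bettiNumber_of_field (ZMod 2) X p]
  rfl

/-- In `ℤ/2`, `-1 = 1`. [folklore] -/
private lemma neg_one_eq_one_zmod_two : (-1 : ZMod 2) = 1 := by decide

/-- **`χ ≡ b_m (mod 2)` for the mod-2 Betti numbers of a closed `2m`-manifold**: the terms `bₖ`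
and `b_{2m-k}`, `k ≠ m`, cancel in pairs modulo `2` (Poincaré duality,
`finrank_singularHomology_zmod_two_eq_of_add_eq`). [cite: HatcherAT2002, §3.3 Cor. 3.37] -/
theorem sum_finrank_singularHomology_zmod_two_eq {m : ℕ} (h : m + m = n) :
    ((∑ k ∈ Finset.range (n + 1), (-1 : ℤ) ^ k *
        (Module.finrank (ZMod 2) (singularHomology (ZMod 2) (ZMod 2) X k) : ℤ) : ℤ) : ZMod 2) =
      (Module.finrank (ZMod 2) (singularHomology (ZMod 2) (ZMod 2) X m) : ZMod 2) := by
  set b : ℕ → ZMod 2 := fun k =>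
    (Module.finrank (ZMod 2) (singularHomology (ZMod 2) (ZMod 2) X k) : ZMod 2) with hb
  have hsymm : ∀ k, k ≤ n → b (n - k) = b k := fun k hk => by
    simp only [hb]
    rw [finrank_singularHomology_zmod_two_eq_of_add_eq (n := n) X (p := n - k) (q := k) (by omega)]
  -- reduce modulo 2: the signs disappear
  have hcast : ((∑ k ∈ Finset.range (n + 1), (-1 : ℤ) ^ k *
      (Module.finrank (ZMod 2) (singularHomology (ZMod 2) (ZMod 2) X k) : ℤ) : ℤ) : ZMod 2) =
      ∑ k ∈ Finset.range (n + 1), b k := by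
    rw [Int.cast_sum]
    refine Finset.sum_congr rfl fun k _ => ?_
    rw [Int.cast_mul, Int.cast_pow, Int.cast_neg, Int.cast_one, neg_one_eq_one_zmod_two, one_pow,
      one_mul, Int.cast_natCast]
  rw [hcast, ← Finset.add_sum_erase _ _ (Finset.mem_range.2 (by omega : m < n + 1))]
  change b m + _ = b m
  rw [add_eq_left]
  -- the involution `k ↦ n - k` on `range (n + 1) ∖ {m}` pairs equal terms
  refine Finset.sum_involution (fun k _ => n - k) ?_ ?_ ?_ ?_
  · intro k hk
    have hk' : k ≤ n := Nat.lt_succ_iff.1 (Finset.mem_range.1 (Finset.mem_of_mem_erase hk))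
    rw [hsymm k hk', CharTwo.add_self_eq_zero]
  · intro k hk _
    have hkm : k ≠ m := Finset.ne_of_mem_erase hk
    omega
  · intro k hk
    have hk' : k ≤ n := Nat.lt_succ_iff.1 (Finset.mem_range.1 (Finset.mem_of_mem_erase hk))
    have hkm : k ≠ m := Finset.ne_of_mem_erase hk
    exact Finset.mem_erase.2 ⟨by omega, Finset.mem_range.2 (by omega)⟩
  · intro k hk
    have hk' : k ≤ n := Nat.lt_succ_iff.1 (Finset.mem_range.1 (Finset.mem_of_mem_erase hk))
    show n - (n - k) = k
    omega

end Betti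

/-! ### §3 `⟨v_m ⌣ v_m, [X]₂⟩ = χ(X) mod 2` -/

section Wu

variable {n m : ℕ} (X : Type u) [TopologicalSpace X] [T2Space X] [CompactSpace X]
  [ChartedSpace (EuclideanSpace ℝ (Fin n)) X]

omit [T2Space X] [CompactSpace X] [ChartedSpace (EuclideanSpace ℝ (Fin n)) X] in
/-- `x ⌣ x = Sqᵐ x` for `x ∈ Hᵐ(X; 𝔽₂)`, with the square landing in degree `n = m + m` written as
the lower square `Sq_{m-m} = Sq₀ : Hᵐ → Hⁿ` (`steenrodSq_self`). [cite: MilnorStasheff1974, §8 (Sqⁿ a = a ⌣ a for |a| = n)] -/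
theorem cupProduct_self_eq_steenrodSqLower (h : m + m = n)
    (x : singularCohomology (ZMod 2) (ZMod 2) X m) :
    cupProduct h x x = steenrodSqLower X m n (m - m) x := by
  subst h
  exact (steenrodSq_self x).symm

/-- **The Wu class `v_m` is the characteristic element of the cup pairing on `Hᵐ(X; 𝔽₂)`**:
`⟨x ⌣ x, [X]₂⟩ = ⟨v_m ⌣ x, [X]₂⟩` for all `x ∈ Hᵐ(X; 𝔽₂)`, `n = m + m`
(Milnor–Stasheff 1974, §11 p. 132: `⟨v_k ⌣ x, μ⟩ = ⟨Sqᵏ x, μ⟩`, and `Sqᵐ x = x ⌣ x`).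
[cite: MilnorStasheff1974, §11 p. 132] -/
theorem kroneckerPairing_cupProduct_self_eq_wuClass (h : m + m = n)
    (x : singularCohomology (ZMod 2) (ZMod 2) X m) :
    kroneckerPairing (ZMod 2) (ZMod 2) X n (cupProduct h x x) (modTwoFundamentalClass X n) =
      kroneckerPairing (ZMod 2) (ZMod 2) X n (cupProduct h (wuClass X n m) x)
        (modTwoFundamentalClass X n) := by
  rw [kroneckerPairing_wuClass_cupProduct h x, cupProduct_self_eq_steenrodSqLower X h x]

/-- **`⟨v_m ⌣ v_m, [X]₂⟩ = dim Hᵐ(X; 𝔽₂) (mod 2)`** for a closed topological manifold of dimension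
`n = m + m`: the cup pairing `B(x, y) = ⟨x ⌣ y, [X]₂⟩` on `Hᵐ(X; 𝔽₂)` is symmetric (graded
commutativity; signs vanish mod 2) and nonsingular (Hatcher Prop. 3.38, the tree's
`isPerfPair_cupPairing_of_field_holds`), with characteristic element `v_m`
(`kroneckerPairing_cupProduct_self_eq_wuClass`), so `B(v_m, v_m) = dim` by
`apply_self_eq_finrank_of_forall_apply_self_eq`. [cite: MilnorStasheff1974, §11 Cor. 11.15] [cite: HatcherAT2002, §3.3 Prop. 3.38] -/
theorem kroneckerPairing_wuClass_sq_eq_finrank (h : m + m = n) :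
    kroneckerPairing (ZMod 2) (ZMod 2) X n (cupProduct h (wuClass X n m) (wuClass X n m))
        (modTwoFundamentalClass X n) =
      (Module.finrank (ZMod 2) (singularCohomology (ZMod 2) (ZMod 2) X m) : ZMod 2) := by
  haveI : Fact (Nat.Prime 2) := ⟨Nat.prime_two⟩
  haveI : Module.Finite (ZMod 2) (singularCohomology (ZMod 2) (ZMod 2) X m) :=
    finite_singularCohomology_of_compact_chartedSpace (ZMod 2) (ZMod 2) (d := n) m
  set B : LinearMap.BilinForm (ZMod 2) (singularCohomology (ZMod 2) (ZMod 2) X m) :=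
    cupPairing (modTwoOrientation X n) h with hBdef
  have hBapp : ∀ x y, B x y =
      kroneckerPairing (ZMod 2) (ZMod 2) X n (cupProduct h x y) (modTwoFundamentalClass X n) :=
    fun x y => rfl
  -- symmetric
  have hsymm : ∀ x y, B x y = B y x := fun x y => by
    rw [hBapp, hBapp, cupProduct_gradedComm_holds (ZMod 2) X h h x y, map_smul,
      LinearMap.smul_apply, neg_one_eq_one_zmod_two, one_pow, one_smul]
  -- nonsingular
  have hsep : ∀ x, (∀ y, B x y = 0) → x = 0 := by
    haveI : (cupPairing (modTwoOrientation X n) h).IsPerfPair := isPerfPair_cupPairing_of_field_holds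
    have hbij : Function.Bijective (cupPairing (modTwoOrientation X n) h) :=
      LinearMap.IsPerfPair.bijective_left (cupPairing (modTwoOrientation X n) h)
    intro x hx
    refine hbij.1 ((LinearMap.ext fun y => ?_).trans (map_zero _).symm)
    exact hx y
  -- the Wu class is the characteristic element
  have hchar : ∀ x, B x x = B (wuClass X n m) x := fun x => by
    rw [hBapp, hBapp, kroneckerPairing_cupProduct_self_eq_wuClass X h x]
  rw [← hBapp]
  exact apply_self_eq_finrank_of_forall_apply_self_eq _ B (wuClass X n m) hsymm hsep hchar rfl

/-- **`χ(X) ≡ ⟨v_m ⌣ v_m, [X]₂⟩ (mod 2)` for a closed topological manifold of dimension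
`n = m + m`** — the Wu-class form of `w_n[M] = χ(M) mod 2` (Milnor–Stasheff 1974, Thm. 11.14 with
Cor. 11.12 / Cor. 11.15: by Wu's formula the top Stiefel–Whitney number is `Σᵢ ⟨vᵢ ⌣ v_{n-i}, [M]⟩`,
of which only `i = m` survives).  Here `χ(X) = Σ_{k ≤ n} (-1)ᵏ rank Hₖ(X; ℤ)`, and the proof
runs: `⟨v_m², [X]⟩ = dim Hᵐ(X; 𝔽₂)` (`kroneckerPairing_wuClass_sq_eq_finrank`) `= dim Hₘ(X; 𝔽₂)`
(universal coefficients over a field) `≡ Σₖ (-1)ᵏ dim Hₖ(X; 𝔽₂)` (Poincaré duality mod 2)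
`= χ(X)` (the Euler characteristic is the same with `𝔽₂` coefficients,
`eulerChar_int_eq_eulerChar_zmod`).  Valid for every closed TOPOLOGICAL manifold.
[cite: MilnorStasheff1974, §11 Thm. 11.14, Cor. 11.12 and Cor. 11.15] -/
theorem kroneckerPairing_wuClass_sq_eq_eulerChar (h : m + m = n) :
    kroneckerPairing (ZMod 2) (ZMod 2) X n (cupProduct h (wuClass X n m) (wuClass X n m))
        (modTwoFundamentalClass X n) =
      ((∑ k ∈ Finset.range (n + 1), (-1 : ℤ) ^ k *
        (Module.finrank ℤ (singularHomology ℤ ℤ X k) : ℤ) : ℤ) : ZMod 2) := by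
  haveI : Fact (Nat.Prime 2) := ⟨Nat.prime_two⟩
  rw [kroneckerPairing_wuClass_sq_eq_finrank X h, eulerChar_int_eq_eulerChar_zmod (p := 2) n X,
    sum_finrank_singularHomology_zmod_two_eq X h,
    finrank_singularCohomology_eq_bettiNumber_of_field (ZMod 2) X m]
  rfl

end Wu

end Literature.AlgebraicTopology.SingularHomology
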